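import Literature.NumberTheory.Sieve.FriedlanderIwaniecPrimesJacobiTwistedProp121SmallLevel
import Literature.NumberTheory.Sieve.FriedlanderIwaniecPrimesJacobiTwistedProp131
import Literature.NumberTheory.Sieve.FriedlanderIwaniecPrimesJacobiTwistedProp141
import HarnessLib

/-!
# Friedlander–Iwaniec, *The polynomial `X² + Y⁴` captures its primes*, §12: Proposition 12.1

[FI, §12, p. 45 of arXiv:math/9811185 = Ann. of Math. (2) 148 (1998), 945–1040]:
"**Proposition 12.1.** For any complex numbers `α_{rs}` supported on `(r, 2s) = 1` we have
`V(D) ≪ {D + D^{1/3}(RS)^{2/3}(log 2RS)⁴ + [D⁻¹(RS)^{3/2} + RS^{3/4} + SR^{3/4}](RS)^ε} ∑∑ τ(r)|α_{rs}|²`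
(12.4), where the implied constant depends only on `ε`."

This file PROVES Proposition 12.1 (`exists_jtV_prop121`) in exactly the shape of hypothesis `h12`
of `jtV_prop131_of_prop121` (`…JacobiTwistedProp131`): the reduction to the flipped form for
coefficients in one class modulo `8` (`jtV_le_of_jtVflip_le`, §14/(12.5)), the regime `RS ≤ D`
(`jtVflip_le_of_mul_le`) and the regime `D < RS` (`exists_jtVflip_le_of_lt`).  With it,
Proposition 13.1 (`jtV_prop131_of_prop121`) becomes unconditional (`exists_jtV_prop131`), and so does
Proposition 14.1 (`jtV_prop141_of_prop121` → `exists_jtV_prop141`).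
No definitions, no named facts (HOME/parity-ideate-lit/FI98-Prop121-MAP.md, g26 addendum).

## References

* J. Friedlander, H. Iwaniec, *The polynomial `X² + Y⁴` captures its primes*, Ann. of Math. (2) 148
  (1998), 945–1040, §12, Proposition 12.1; §13, Proposition 13.1. [FriedlanderIwaniecAnnals1998]
-/

noncomputable section

open Finset Real Complex
open scoped NumberTheorySymbols ArithmeticFunction.sigma ComplexConjugate

namespace Literature.NumberTheory.Sieve.FriedlanderIwaniecPrimes

/-- **Proposition 12.1** [FI, (12.4)]: for every `0 < ε ≤ 1` there is `C₁₂ ≥ 0` such that for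
`D, R, S ≥ 1` and `α` supported on `(r, 2s) = 1`,
`V(D) ≤ C₁₂ {D + D^{1/3}(RS)^{2/3}(log 2RS)⁴ + [D⁻¹(RS)^{3/2} + RS^{3/4} + SR^{3/4}](RS)^{ε/2}} ∑∑ τ(r)|α_{rs}|²`.
[cite: FriedlanderIwaniecAnnals1998, §12, Proposition 12.1] -/
theorem exists_jtV_prop121 {ε : ℝ} (hε : 0 < ε) (hε1 : ε ≤ 1) :
    ∃ C₁₂ : ℝ, 0 ≤ C₁₂ ∧ ∀ (D R S : ℕ) (α : ℕ → ℕ → ℂ), 1 ≤ D → 1 ≤ R → 1 ≤ S →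
      (∀ r s, α r s ≠ 0 → r.Coprime (2 * s)) →
      jtV D (2 * D) R S α ≤ C₁₂ * ((D : ℝ) + (D : ℝ) ^ (1 / 3 : ℝ) * ((R : ℝ) * S) ^ (2 / 3 : ℝ) *
            Real.log (2 * R * S) ^ 4 +
          ((D : ℝ)⁻¹ * ((R : ℝ) * S) ^ (3 / 2 : ℝ) + R * (S : ℝ) ^ (3 / 4 : ℝ) + S * (R : ℝ) ^ (3 / 4 : ℝ)) *
            ((R : ℝ) * S) ^ (ε / 2)) *
        ∑ r ∈ Ioc R (2 * R), ∑ s ∈ Ioc S (2 * S), (σ 0 r : ℝ) * ‖α r s‖ ^ 2 := by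
  obtain ⟨C, hC, hlt⟩ := exists_jtVflip_le_of_lt hε hε1
  refine ⟨4 * (C + 531), by positivity, ?_⟩
  intro D R S α hD hR hS hα
  have hD0 : (0 : ℝ) < D := by exact_mod_cast hD
  have hR1 : (1 : ℝ) ≤ R := by exact_mod_cast hR
  have hS1 : (1 : ℝ) ≤ S := by exact_mod_cast hS
  have hX1 : (1 : ℝ) ≤ (R : ℝ) * S := by nlinarith
  -- the bound is nonnegative and dominates `D + D⁻¹(RS)^{3/2}`
  set B : ℝ := (D : ℝ) + (D : ℝ) ^ (1 / 3 : ℝ) * ((R : ℝ) * S) ^ (2 / 3 : ℝ) *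
      Real.log (2 * R * S) ^ 4 +
    ((D : ℝ)⁻¹ * ((R : ℝ) * S) ^ (3 / 2 : ℝ) + R * (S : ℝ) ^ (3 / 4 : ℝ) + S * (R : ℝ) ^ (3 / 4 : ℝ)) *
      ((R : ℝ) * S) ^ (ε / 2) with hB
  have hlog0 : 0 ≤ Real.log (2 * R * S) := Real.log_nonneg (by nlinarith)
  have hXe1 : 1 ≤ ((R : ℝ) * S) ^ (ε / 2) := Real.one_le_rpow hX1 (by positivity)
  have hB0 : 0 ≤ B := by positivity
  have hBD : (D : ℝ) + (D : ℝ)⁻¹ * ((R : ℝ) * S) ^ (3 / 2 : ℝ) ≤ B := by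
    rw [hB]
    have h1 : 0 ≤ (D : ℝ) ^ (1 / 3 : ℝ) * ((R : ℝ) * S) ^ (2 / 3 : ℝ) * Real.log (2 * R * S) ^ 4 := by
      positivity
    have h2 : (D : ℝ)⁻¹ * ((R : ℝ) * S) ^ (3 / 2 : ℝ) ≤
        ((D : ℝ)⁻¹ * ((R : ℝ) * S) ^ (3 / 2 : ℝ) + R * (S : ℝ) ^ (3 / 4 : ℝ) +
          S * (R : ℝ) ^ (3 / 4 : ℝ)) * ((R : ℝ) * S) ^ (ε / 2) := by
      have h3 : (D : ℝ)⁻¹ * ((R : ℝ) * S) ^ (3 / 2 : ℝ) ≤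
          (D : ℝ)⁻¹ * ((R : ℝ) * S) ^ (3 / 2 : ℝ) + R * (S : ℝ) ^ (3 / 4 : ℝ) +
            S * (R : ℝ) ^ (3 / 4 : ℝ) := by
        have : 0 ≤ R * (S : ℝ) ^ (3 / 4 : ℝ) := by positivity
        have : 0 ≤ S * (R : ℝ) ^ (3 / 4 : ℝ) := by positivity
        linarith
      exact h3.trans (le_mul_of_one_le_right (by positivity) hXe1)
    linarith
  -- `τ ≥ 1` on the box
  have hσ1 : ∀ r ∈ Ioc R (2 * R), (1 : ℝ) ≤ (σ 0 r : ℝ) := by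
    intro r hr
    have hr0 : r ≠ 0 := by have := (mem_Ioc.mp hr).1; omega
    rw [ArithmeticFunction.sigma_zero_apply]
    exact_mod_cast Finset.card_pos.mpr ⟨1, Nat.one_mem_divisors.mpr hr0⟩
  have hodd : ∀ r s, α r s ≠ 0 → Odd r := fun r s h =>
    Nat.coprime_two_right.mp (Nat.Coprime.coprime_dvd_right (dvd_mul_right 2 s) (hα r s h))
  have key := jtV_le_of_jtVflip_le (D₁ := D) (D₂ := 2 * D) (R := R) (S := S)
    (Δ := (C + 531) * B) (w := fun r _ => (σ 0 r : ℝ)) (P := fun r s => r.Coprime (2 * s))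
    (fun β hβ hβ8 => by
      have hNT : ∑ r ∈ Ioc R (2 * R), ∑ s ∈ Ioc S (2 * S), ‖β r s‖ ^ 2 ≤
          ∑ r ∈ Ioc R (2 * R), ∑ s ∈ Ioc S (2 * S), (σ 0 r : ℝ) * ‖β r s‖ ^ 2 := by
        refine sum_le_sum fun r hr => sum_le_sum fun s _ => ?_
        calc ‖β r s‖ ^ 2 = 1 * ‖β r s‖ ^ 2 := (one_mul _).symm
          _ ≤ (σ 0 r : ℝ) * ‖β r s‖ ^ 2 := mul_le_mul_of_nonneg_right (hσ1 r hr) (sq_nonneg _)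
      have hT0 : 0 ≤ ∑ r ∈ Ioc R (2 * R), ∑ s ∈ Ioc S (2 * S), (σ 0 r : ℝ) * ‖β r s‖ ^ 2 :=
        sum_nonneg fun _ _ => sum_nonneg fun _ _ => mul_nonneg (Nat.cast_nonneg _) (sq_nonneg _)
      by_cases hlt' : D < R * S
      · have hβ4 : ∀ r₁ s₁ r₂ s₂, β r₁ s₁ ≠ 0 → β r₂ s₂ ≠ 0 → r₁ % 4 = r₂ % 4 := by
          intro r₁ s₁ r₂ s₂ h1 h2
          have h8 := hβ8 r₁ s₁ r₂ s₂ h1 h2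
          rw [← Nat.mod_mod_of_dvd r₁ (by norm_num : 4 ∣ 8), ← Nat.mod_mod_of_dvd r₂ (by norm_num : 4 ∣ 8), h8]
        refine (hlt D R S β hD hR hS hlt' hβ hβ4).trans ?_
        show C * B * _ ≤ (C + 531) * B * _
        exact mul_le_mul_of_nonneg_right (mul_le_mul_of_nonneg_right (by linarith) hB0) hT0
      · have hRS : R * S ≤ D := not_lt.mp hlt'
        have hβcop : ∀ r s, β r s ≠ 0 → r.Coprime s := fun r s h =>
          Nat.Coprime.coprime_dvd_right (dvd_mul_left s 2) (hβ r s h)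
        refine (jtVflip_le_of_mul_le hS hR hD hRS β hβcop).trans ?_
        have h1 : 435 * (D : ℝ) + 96 * ((R : ℝ) * S) ^ (3 / 2 : ℝ) / D ≤ (C + 531) * B := by
          have e : 96 * ((R : ℝ) * S) ^ (3 / 2 : ℝ) / D = 96 * ((D : ℝ)⁻¹ * ((R : ℝ) * S) ^ (3 / 2 : ℝ)) := by
            rw [div_eq_mul_inv]; ring
          rw [e]
          have h0 : 0 ≤ (D : ℝ)⁻¹ * ((R : ℝ) * S) ^ (3 / 2 : ℝ) := by positivity
          have h2 : 435 * (D : ℝ) + 96 * ((D : ℝ)⁻¹ * ((R : ℝ) * S) ^ (3 / 2 : ℝ)) ≤ 531 * B := by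
            linarith only [hBD, h0, hD0.le]
          have h3 : 531 * B ≤ (C + 531) * B := mul_le_mul_of_nonneg_right (by linarith only [hC]) hB0
          exact h2.trans h3
        calc (435 * (D : ℝ) + 96 * ((R : ℝ) * S) ^ (3 / 2 : ℝ) / D) *
              ∑ r ∈ Ioc R (2 * R), ∑ s ∈ Ioc S (2 * S), ‖β r s‖ ^ 2
            ≤ (C + 531) * B * ∑ r ∈ Ioc R (2 * R), ∑ s ∈ Ioc S (2 * S), (σ 0 r : ℝ) * ‖β r s‖ ^ 2 :=
              mul_le_mul h1 hNT (sum_nonneg fun _ _ => sum_nonneg fun _ _ => sq_nonneg _)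
                (by positivity))
    hα hodd
  refine key.trans (le_of_eq ?_)
  rw [hB]
  ring

/-- **Proposition 13.1, unconditional** [FI, (13.1)]: Proposition 12.1 (`exists_jtV_prop121`) fed
into the general-`D₂` form `jtV_prop131_of_prop121`. [cite: FriedlanderIwaniecAnnals1998, §13,
Proposition 13.1] -/
theorem exists_jtV_prop131 {ε : ℝ} (hε : 0 < ε) (hε1 : ε ≤ 1) :
    ∃ C₁₃ : ℝ, 0 ≤ C₁₃ ∧ ∀ (D R S : ℕ) (α : ℕ → ℕ → ℂ), 1 ≤ D → 1 ≤ R → 1 ≤ S →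
      (∀ r s, α r s ≠ 0 → r.Coprime (2 * s)) →
      jtV D (2 * D) R S α ≤ C₁₃ * (((D : ℝ) * ((R : ℝ) + S) ^ (1 / 4 : ℝ) * ((R : ℝ) * S) ^ (1 / 4 : ℝ) +
          (D : ℝ) ^ (-(1 / 2 : ℝ)) * ((R : ℝ) + S) ^ (1 / 8 : ℝ) * ((R : ℝ) * S) ^ (9 / 8 : ℝ)) *
            ((R : ℝ) * S) ^ ε) *
        ∑ r ∈ Ioc R (2 * R), ∑ s ∈ Ioc S (2 * S), (σ 0 r : ℝ) * ‖α r s‖ ^ 2 := by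
  obtain ⟨C₁₂, hC₁₂, h12⟩ := exists_jtV_prop121 hε hε1
  exact jtV_prop131_of_prop121 hε hε1 hC₁₂ h12

/-- **Proposition 14.1, unconditional** [FI, (14.1)]: Proposition 12.1 (`exists_jtV_prop121`) fed
into `jtV_prop141_of_prop121` (Prop. 11.1 + Prop. 13.1 + Prop. 12.1 on the three ranges):
`V(D) ≤ C₁₄ {D + D^{-1/2}RS + D^{1/3}(RS)^{2/3}(log 2RS)⁴ + (R+S)^{1/12}(RS)^{11/12+ε}} ∑∑ τ(r)|α_{rs}|²`.
[cite: FriedlanderIwaniecAnnals1998, §14, Proposition 14.1] -/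
theorem exists_jtV_prop141 {ε : ℝ} (hε : 0 < ε) (hε1 : ε ≤ 1) :
    ∃ C₁₄ : ℝ, 0 ≤ C₁₄ ∧ ∀ (D R S : ℕ) (α : ℕ → ℕ → ℂ), 1 ≤ D → 1 ≤ R → 1 ≤ S →
      (∀ r s, α r s ≠ 0 → r.Coprime (2 * s)) →
      jtV D (2 * D) R S α ≤ C₁₄ *
        ((D : ℝ) + (D : ℝ) ^ (-(1 / 2 : ℝ)) * ((R : ℝ) * S) +
          (D : ℝ) ^ (1 / 3 : ℝ) * ((R : ℝ) * S) ^ (2 / 3 : ℝ) * Real.log (2 * R * S) ^ 4 +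
          ((R : ℝ) + S) ^ (1 / 12 : ℝ) * ((R : ℝ) * S) ^ (11 / 12 : ℝ) * ((R : ℝ) * S) ^ ε) *
        ∑ r ∈ Ioc R (2 * R), ∑ s ∈ Ioc S (2 * S), (σ 0 r : ℝ) * ‖α r s‖ ^ 2 := by
  obtain ⟨C₁₂, hC₁₂, h12⟩ := exists_jtV_prop121 hε hε1
  exact jtV_prop141_of_prop121 hε hε1 hC₁₂ h12

end Literature.NumberTheory.Sieve.FriedlanderIwaniecPrimes
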